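import Summits.MatrixMultiplication.OmegaCensus.STPPSmallPatternThreeAPFreeSplitRungs

/-!
# ω-census, `(1,2,2)²¹` host law: seed types by the SPLIT 3-AP-free route (no search)

HONEST FRAMING (pub-omega census; verbatim): lottery ticket; floor = certified bounds/negative ranges.
Census STRUCTURE bookkeeping of the STPP track (seat pub-omega-stpp-3, gen 30; STRUCTURE row B5, column `T2`, §2 C10 row 21), not progress on `ω`:
small patterns in small groups bound no exponent.

2 seed type(s) of the `k = 21` plans that the product routes, the cyclic rays and the T1-ray fat lifts leave open and that the split law
`STPPSmallPatternThreeAPFreeSplit.lean` (gen 30) settles WITHOUT SEARCH: a pairwise-coprime set of coordinates of product `≥ 2F + 1 = 141`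
(`F = 70` = the largest element of the Salem–Spencer seed of size 21) carries `g`, two further coordinates (or one of order `≥ 4`) carry the
sign-independent `κ₁, κ₂`; `exists_isSTPP_122pow21_of_apSplit` + one kernel `decide` of the bounded independence hypothesis each:
`ℤ/71 × ℤ/2 × ℤ/2 × ℤ/2` (568), `ℤ/73 × ℤ/2 × ℤ/2 × ℤ/2` (584).

References: H. Cohn, R. Kleinberg, B. Szegedy, C. Umans, FOCS 2005 (arXiv:math/0511460), Def. 5.1.  Generator HOME `pub-omega-stpp-3-g30/code/k30/mk_splitseeds.py`.
-/

open Literature.Computability.AlgebraicComplexity Finset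

namespace Summit.MatrixMultiplication.OmegaCensus

/-- **`(1,2,2)²¹ ⊆ ℤ/71 × ℤ/2 × ℤ/2 × ℤ/2`** (order `568`) by the SPLIT 3-AP-free route, no search: `g = (1, 1, 0, 0)` generates the cyclic factor
`ℤ/71 × ℤ/2 ≅ ℤ/142` (`142 ≥ 2F + 1 = 141`), `κ₁ = (0, 0, 1, 0)`, `κ₂ = (0, 0, 0, 1)` (basis vectors of `ℤ/2 × ℤ/2`); the bounded independence hypothesis
(`c ∈ [−140, 140]`, `a, b ∈ {−1,0,1}`) is decided in the kernel. [cite: CohnKleinbergSzegedyUmans2005, Def. 5.1] -/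
theorem exists_isSTPP_122pow21_seed_71_2_2_2 :
    ∃ A B C : Fin 21 → Finset (ZMod 71 × ZMod 2 × ZMod 2 × ZMod 2), IsSTPP A B C ∧ ∀ i, (A i).card = 1 ∧ (B i).card = 2 ∧ (C i).card = 2 :=
  exists_isSTPP_122pow21_of_apSplit (G := ZMod 71 × ZMod 2 × ZMod 2 × ZMod 2) (1, 1, 0, 0) (0, 0, 1, 0) (0, 0, 0, 1) (by decide +kernel)


/-- **`(1,2,2)²¹ ⊆ ℤ/73 × ℤ/2 × ℤ/2 × ℤ/2`** (order `584`) by the SPLIT 3-AP-free route, no search: `g = (1, 1, 0, 0)` generates the cyclic factor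
`ℤ/73 × ℤ/2 ≅ ℤ/146` (`146 ≥ 2F + 1 = 141`), `κ₁ = (0, 0, 1, 0)`, `κ₂ = (0, 0, 0, 1)` (basis vectors of `ℤ/2 × ℤ/2`); the bounded independence hypothesis
(`c ∈ [−140, 140]`, `a, b ∈ {−1,0,1}`) is decided in the kernel. [cite: CohnKleinbergSzegedyUmans2005, Def. 5.1] -/
theorem exists_isSTPP_122pow21_seed_73_2_2_2 :
    ∃ A B C : Fin 21 → Finset (ZMod 73 × ZMod 2 × ZMod 2 × ZMod 2), IsSTPP A B C ∧ ∀ i, (A i).card = 1 ∧ (B i).card = 2 ∧ (C i).card = 2 :=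
  exists_isSTPP_122pow21_of_apSplit (G := ZMod 73 × ZMod 2 × ZMod 2 × ZMod 2) (1, 1, 0, 0) (0, 0, 1, 0) (0, 0, 0, 1) (by decide +kernel)

end Summit.MatrixMultiplication.OmegaCensus
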